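import Mathlib
import Summits.Ventures.PercRepro.TriangleCapNearStar

/-!
# PercRepro — THE FIFTH-BEST VALUE OF THE `K₄⁻`-FREE CHERRY TABLE, AND THE TOP OF THE PAIR-COUNT SPECTRUM
(p3, gen 50; part 213)

THE FIFTH VALUE (`cherry_fifth_best`, `r ≥ 6`): the pair count `disjEdgePairs` is even (`disjEdgePairs_even`: both
`Σ d²` and `s (s + 1)` are), so on the `a`-bipartite class a gap that is none of `0`, `2 (r − 2)`, `2 (r − 1)`,
`4 (r − 3)` is at least `4 (r − 3) + 2` (the trichotomy `bipSub_gap_trichotomy` and parity); off the class the gap is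
`≥ stabGapFull k a r`.  The value `closed − (4 (r − 3) + 2)` is attained by `twoPairsAtTwoLeaves`: `K_{a,k−a}` minus an
`(r − 2)`-star at `0` minus the pairs `{1, a}` and `{2, a + 1}` at two DIFFERENT leaves (`Σ d²` drops by `2 k − 2`
twice) — so the fifth-best value is `closed − min (4 (r − 3) + 2) (stabGapFull k a r)`.

THE TOP OF THE SPECTRUM (`sum_deg_sq_two_off_band`, `pair_count_spectrum`): by the near-star formula a
triangle-free graph with `s` edges and a vertex of degree `s − 2` has `Σ d² = s (s + 1) − 4 (s − 3) − 2 j` for some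
`j ≤ 3` (the three counts `|N(w) ∩ e|`, `|N(w) ∩ f|`, `|e ∩ f|` are `0/1`); with the max-degree trichotomy and the
level-two stability (`Δ ≤ s − 3` ⇒ `Σ d² + 6 (s − 4) ≤ s (s + 1)`), for `s ≥ 8` the values of `Σ_v d(v)²` over the
triangle-free graphs with `s` edges are `s (s + 1)`, `s (s + 1) − 2 (s − 2)`, `s (s + 1) − 2 (s − 1)`, the band
`s (s + 1) − 4 (s − 3) − 2 j` (`j ≤ 3`), or at most `s (s + 1) − 6 (s − 4)` — nothing else.

Axioms: standard.
-/

namespace PercRepro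

namespace TriangleCap

namespace C047

open Finset

variable {V : Type*} [Fintype V] [DecidableEq V]

/-- The pair count `disjEdgePairs D` is even. -/
theorem disjEdgePairs_even (D : SimpleGraph V) [DecidableRel D.Adj] : Even (disjEdgePairs D) := by
  have h := sum_deg_sq_add_disjEdgePairs D
  obtain ⟨p, hp⟩ := even_sum_deg_sq D
  obtain ⟨q, hq⟩ := Nat.even_mul_succ_self D.edgeFinset.card
  exact ⟨q - p, by omega⟩

/-- **THE TWO PAIRS AT TWO LEAVES** on `Fin n`: `K_{a,n−a}` minus an `(r − 2)`-star at `0` (leaves `a, …, a + r − 3`)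
minus the pairs `{1, a}` and `{2, a + 1}`. -/
abbrev twoPairsAtTwoLeaves (n a r : ℕ) (h1 : 1 < n) (h2 : 2 < n) (ha : a < n) (ha1 : a + 1 < n) :
    SimpleGraph (Fin n) :=
  delEdge (delEdge (bipMinusStar n a (r - 2)) ⟨1, h1⟩ ⟨a, ha⟩) ⟨2, h2⟩ ⟨a + 1, ha1⟩

/-- The arithmetic of the witness: `S₀ + (r − 2)(n − 1 − (r − 2)) = E₀ n`, `E₂ + 2 = E₀`, `S₁ + 2 (n − 1) = S₀ + 2`,
`S₂ + 2 (n − 1) = S₁ + 2` give `S₂ + r (n − 1 − r) + (4 (r − 3) + 2) = E₂ n`. -/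
theorem twoPairsAtTwoLeaves_arith (n r E₀ E₂ S₀ S₁ S₂ : ℕ) (hr : 3 ≤ r) (hn : r + 1 ≤ n)
    (hS0 : S₀ + (r - 2) * (n - 1 - (r - 2)) = E₀ * n) (hE : E₂ + 2 = E₀)
    (hS1 : S₁ + 2 * (n - 1) = S₀ + 2) (hS2 : S₂ + 2 * (n - 1) = S₁ + 2) :
    S₂ + r * (n - 1 - r) + (4 * (r - 3) + 2) = E₂ * n := by
  obtain ⟨r', rfl⟩ : ∃ r', r = r' + 3 := ⟨r - 3, by omega⟩
  obtain ⟨t, rfl⟩ : ∃ t, n = r' + 4 + t := ⟨n - (r' + 4), by omega⟩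
  subst hE
  have e1 : r' + 3 - 2 = r' + 1 := by omega
  have e2 : r' + 4 + t - 1 - (r' + 1) = t + 2 := by omega
  have e3 : r' + 4 + t - 1 - (r' + 3) = t := by omega
  have e4 : r' + 3 - 3 = r' := by omega
  have e5 : r' + 4 + t - 1 = r' + 3 + t := by omega
  rw [e1, e2] at hS0
  rw [e5] at hS1 hS2
  rw [e3, e4]
  zify at hS0 hS1 hS2 ⊢
  linear_combination hS0 + hS1 + hS2

/-- **THE WITNESS ATTAINS `closed − (4 (r − 3) + 2)`:** for `3 ≤ a`, `4 ≤ r`, `a + r ≤ n + 1`, `r + 1 ≤ n`. -/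
theorem twoPairsAtTwoLeaves_value (n a r : ℕ) (ha3 : 3 ≤ a) (hr4 : 4 ≤ r) (han : a + r ≤ n + 1) (hn : r + 1 ≤ n) :
    K4mFree (twoPairsAtTwoLeaves n a r (by omega) (by omega) (by omega) (by omega)) ∧
      (twoPairsAtTwoLeaves n a r (by omega) (by omega) (by omega) (by omega)).edgeFinset.card + r = a * (n - a) ∧
      ∑ v, deg (twoPairsAtTwoLeaves n a r (by omega) (by omega) (by omega) (by omega)) v *
          deg (twoPairsAtTwoLeaves n a r (by omega) (by omega) (by omega) (by omega)) v + r * (n - 1 - r) +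
          (4 * (r - 3) + 2) =
        (twoPairsAtTwoLeaves n a r (by omega) (by omega) (by omega) (by omega)).edgeFinset.card * n := by
  have h1 : 1 < n := by omega
  have h2 : 2 < n := by omega
  have ha : a < n := by omega
  have ha1 : a + 1 < n := by omega
  have hadj1 : (bipMinusStar n a (r - 2)).Adj ⟨1, h1⟩ ⟨a, ha⟩ := by
    rw [bipMinusStar_adj]
    simp only
    exact ⟨Or.inl ⟨by omega, by omega⟩, by omega⟩
  have hadj2 : (bipMinusStar n a (r - 2)).Adj ⟨2, h2⟩ ⟨a + 1, ha1⟩ := by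
    rw [bipMinusStar_adj]
    simp only
    exact ⟨Or.inl ⟨by omega, by omega⟩, by omega⟩
  have hadj2' : (delEdge (bipMinusStar n a (r - 2)) ⟨1, h1⟩ ⟨a, ha⟩).Adj ⟨2, h2⟩ ⟨a + 1, ha1⟩ := by
    rw [delEdge_adj]
    refine ⟨hadj2, ?_⟩
    simp only [Fin.mk.injEq]
    omega
  have hd1 : deg (bipMinusStar n a (r - 2)) ⟨1, h1⟩ = n - a :=
    deg_bipMinusStar_one_row n a (r - 2) (by omega) (by omega)
  have hda : deg (bipMinusStar n a (r - 2)) ⟨a, ha⟩ = a - 1 := by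
    rw [deg_bipMinusStar n a (r - 2) (by omega) (by omega)]
    rw [if_neg (by simp only; omega), if_pos (by
      unfold rightStar
      simp only [mem_filter, mem_univ, true_and]
      omega)]
  have hd2 : deg (bipMinusStar n a (r - 2)) ⟨2, h2⟩ = n - a := by
    rw [deg_bipMinusStar n a (r - 2) (by omega) (by omega)]
    rw [if_neg (by simp only; omega), if_neg (by
      unfold rightStar
      simp only [mem_filter, mem_univ, true_and]
      omega)]
    exact deg_bip_of_lt n a (by omega) _ (by simp only; omega)
  have hda1 : deg (bipMinusStar n a (r - 2)) ⟨a + 1, ha1⟩ = a - 1 := by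
    rw [deg_bipMinusStar n a (r - 2) (by omega) (by omega)]
    rw [if_neg (by simp only; omega), if_pos (by
      unfold rightStar
      simp only [mem_filter, mem_univ, true_and]
      omega)]
  have hd2' : deg (delEdge (bipMinusStar n a (r - 2)) ⟨1, h1⟩ ⟨a, ha⟩) ⟨2, h2⟩ = n - a := by
    have := deg_delEdge (bipMinusStar n a (r - 2)) hadj1 ⟨2, h2⟩
    rw [if_neg (by simp only [Fin.mk.injEq]; omega)] at this
    omega
  have hda1' : deg (delEdge (bipMinusStar n a (r - 2)) ⟨1, h1⟩ ⟨a, ha⟩) ⟨a + 1, ha1⟩ = a - 1 := by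
    have := deg_delEdge (bipMinusStar n a (r - 2)) hadj1 ⟨a + 1, ha1⟩
    rw [if_neg (by simp only [Fin.mk.injEq]; omega)] at this
    omega
  have hS0 := sum_deg_sq_bipMinusStar n a (r - 2) (by omega) (by omega) (by omega)
  rw [Fintype.card_fin] at hS0
  have hE0 := card_edges_bipMinusStar n a (r - 2) (by omega) (by omega)
  have hE1 := card_edges_delEdge (bipMinusStar n a (r - 2)) hadj1
  have hE2 := card_edges_delEdge (delEdge (bipMinusStar n a (r - 2)) ⟨1, h1⟩ ⟨a, ha⟩) hadj2'
  have hS1 := sum_deg_sq_delEdge (bipMinusStar n a (r - 2)) hadj1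
  rw [hd1, hda] at hS1
  have hS2 := sum_deg_sq_delEdge (delEdge (bipMinusStar n a (r - 2)) ⟨1, h1⟩ ⟨a, ha⟩) hadj2'
  rw [hd2', hda1'] at hS2
  have e1 : n - a + (a - 1) = n - 1 := by omega
  rw [e1] at hS1 hS2
  refine ⟨?_, ?_, ?_⟩
  · exact k4mFree_of_le _ _ (delEdge_le _ _ _)
      (k4mFree_of_le _ _ (delEdge_le _ _ _) (k4mFree_bipMinusStar n a (r - 2)))
  · show (delEdge (delEdge (bipMinusStar n a (r - 2)) ⟨1, h1⟩ ⟨a, ha⟩) ⟨2, h2⟩ ⟨a + 1, ha1⟩).edgeFinset.card + r =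
      a * (n - a)
    omega
  · show ∑ v, deg (delEdge (delEdge (bipMinusStar n a (r - 2)) ⟨1, h1⟩ ⟨a, ha⟩) ⟨2, h2⟩ ⟨a + 1, ha1⟩) v *
        deg (delEdge (delEdge (bipMinusStar n a (r - 2)) ⟨1, h1⟩ ⟨a, ha⟩) ⟨2, h2⟩ ⟨a + 1, ha1⟩) v +
        r * (n - 1 - r) + (4 * (r - 3) + 2) =
      (delEdge (delEdge (bipMinusStar n a (r - 2)) ⟨1, h1⟩ ⟨a, ha⟩) ⟨2, h2⟩ ⟨a + 1, ha1⟩).edgeFinset.card * n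
    exact twoPairsAtTwoLeaves_arith n r _ _ _ _ _ (by omega) hn hS0 (by omega) hS1 hS2

/-- **THE FIFTH-BEST VALUE OF THE CHERRY TABLE:** on every cell `(k, a, r)` with `3 ≤ a`, `6 ≤ r`, `2 a + r ≤ k`
(`r + 7 ≤ k` on the row `a = 3`), every `K₄⁻`-free graph with `a (k − a) − r` edges whose `Σ_v d(v)²` is none of the
four top values (closed, `closed − 2 (r − 2)`, `closed − 2 (r − 1)`, `closed − min (4 (r − 3)) (stabGapFull k a r)`)
satisfies `Σ_v d(v)² + r (k − 1 − r) + min (4 (r − 3) + 2) (stabGapFull k a r) ≤ m k`, and the value is attained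
(two pairs at two leaves of the star when `4 (r − 3) + 2 ≤ stabGapFull k a r`, the non-bipartite witness otherwise). -/
theorem cherry_fifth_best (k a r : ℕ) (ha3 : 3 ≤ a) (hr6 : 6 ≤ r) (hk : 2 * a + r ≤ k)
    (hk3 : a = 3 → r + 7 ≤ k) :
    (∀ (D : SimpleGraph (Fin k)) [DecidableRel D.Adj], K4mFree D → D.edgeFinset.card + r = a * (k - a) →
        ∑ v, deg D v * deg D v + r * (k - 1 - r) ≠ D.edgeFinset.card * k →
        ∑ v, deg D v * deg D v + r * (k - 1 - r) + 2 * (r - 2) ≠ D.edgeFinset.card * k →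
        ∑ v, deg D v * deg D v + r * (k - 1 - r) + 2 * (r - 1) ≠ D.edgeFinset.card * k →
        ∑ v, deg D v * deg D v + r * (k - 1 - r) + min (4 * (r - 3)) (stabGapFull k a r) ≠
          D.edgeFinset.card * k →
        ∑ v, deg D v * deg D v + r * (k - 1 - r) + min (4 * (r - 3) + 2) (stabGapFull k a r) ≤
          D.edgeFinset.card * k) ∧
      ∃ (D : SimpleGraph (Fin k)) (_ : DecidableRel D.Adj), K4mFree D ∧ D.edgeFinset.card + r = a * (k - a) ∧
        ∑ v, deg D v * deg D v + r * (k - 1 - r) + min (4 * (r - 3) + 2) (stabGapFull k a r) =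
          D.edgeFinset.card * k := by
  have hcard : Fintype.card (Fin k) = k := Fintype.card_fin k
  refine ⟨?_, ?_⟩
  · intro D _ hK hm hne1 hne2 hne3 hne4
    by_cases hbip : ∃ A : Finset (Fin k), A.card = a ∧ BipSub D A
    · obtain ⟨A, hA, hB⟩ := hbip
      have hH := bipSub_sum_deg_sq_add_disjEdgePairs D A hB a r hA (by rw [hcard]; exact hm)
        (by rw [hcard]; omega)
      rw [hcard] at hH
      have ht := bipSub_gap_trichotomy D A hB a r hA (by rw [hcard]; exact hm) (by omega) (by rw [hcard]; omega)
      rw [hcard] at ht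
      obtain ⟨q, hq⟩ := disjEdgePairs_even (missingGraph D A)
      have hmin := min_le_left (4 * (r - 3) + 2) (stabGapFull k a r)
      rcases ht with h | h | h | h
      · exact absurd h hne1
      · exact absurd h hne2
      · exact absurd h hne3
      · -- the gap is `≥ 4 (r − 3)`, even, and not `4 (r − 3)` unless that is not the fourth value
        by_cases hle : 4 * (r - 3) ≤ stabGapFull k a r
        · rw [min_eq_left hle] at hne4
          omega
        · have hlt := not_le.mp hle
          have hmin2 := min_le_right (4 * (r - 3) + 2) (stabGapFull k a r)
          omega
    · have h := (stab_table_rows_ge_three k a r ha3 hk (by omega) hk3).1 D hK hm hbip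
      have hmin := min_le_right (4 * (r - 3) + 2) (stabGapFull k a r)
      omega
  · by_cases hle : 4 * (r - 3) + 2 ≤ stabGapFull k a r
    · rw [min_eq_left hle]
      obtain ⟨hK, hE, hS⟩ := twoPairsAtTwoLeaves_value k a r ha3 (by omega) (by omega) (by omega)
      exact ⟨twoPairsAtTwoLeaves k a r (by omega) (by omega) (by omega) (by omega), inferInstance, hK, hE, hS⟩
    · rw [min_eq_right (le_of_lt (not_le.mp hle))]
      obtain ⟨D, inst, hK, hE, -, hS⟩ := (stab_table_rows_ge_three k a r ha3 hk (by omega) hk3).2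
      exact ⟨D, inst, hK, hE, hS⟩

/-- **THE `Δ = s − 2` BAND:** a triangle-free graph with `s ≥ 3` edges and a vertex of degree `s − 2` has
`Σ_v d(v)² + 4 (s − 3) + 2 j = s (s + 1)` for some `j ≤ 3`. -/
theorem sum_deg_sq_two_off_band (H : SimpleGraph V) [DecidableRel H.Adj] (hfree : H.CliqueFree 3) (w : V)
    (hw : deg H w + 2 = H.edgeFinset.card) (hs3 : 3 ≤ H.edgeFinset.card) :
    ∃ j, j ≤ 3 ∧ ∑ v, deg H v * deg H v + 4 * (H.edgeFinset.card - 3) + 2 * j =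
      H.edgeFinset.card * (H.edgeFinset.card + 1) := by
  obtain ⟨e, f, he, hf, hef, hwe, hwf, hall⟩ := two_off_of_deg H w hw
  have hform := sum_deg_sq_two_off H w e f he hf hwe hwf hef hall
  have c1 := card_adj_mem_le_one H hfree w e he
  have c2 := card_adj_mem_le_one H hfree w f hf
  have c3 := card_mem_mem_le_one e f hef
  refine ⟨3 - ((univ.filter (fun v => H.Adj w v ∧ v ∈ e)).card + (univ.filter (fun v => H.Adj w v ∧ v ∈ f)).card +
    (univ.filter (fun v => v ∈ e ∧ v ∈ f)).card), by omega, ?_⟩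
  obtain ⟨d, hd⟩ : ∃ d, deg H w = d := ⟨_, rfl⟩
  rw [hd] at hw hform
  rw [← hw, hform]
  have e1 : (d + 2) * (d + 2 + 1) = d * d + 5 * d + 6 := by ring
  have e2 : d + 2 - 3 = d - 1 := by omega
  rw [e1, e2]
  omega

/-- **THE TOP OF THE PAIR-COUNT SPECTRUM:** for `s ≥ 8`, a triangle-free graph with `s` edges has `Σ_v d(v)²` equal to
`s (s + 1)`, or `s (s + 1) − 2 (s − 2)`, or `s (s + 1) − 2 (s − 1)`, or `s (s + 1) − 4 (s − 3) − 2 j` for some `j ≤ 3`,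
or at most `s (s + 1) − 6 (s − 4)`. -/
theorem pair_count_spectrum (H : SimpleGraph V) [DecidableRel H.Adj] (hfree : H.CliqueFree 3) (s : ℕ)
    (hs : 8 ≤ s) (hm : H.edgeFinset.card = s) :
    ∑ v, deg H v * deg H v = s * (s + 1) ∨ ∑ v, deg H v * deg H v + 2 * (s - 2) = s * (s + 1) ∨
      ∑ v, deg H v * deg H v + 2 * (s - 1) = s * (s + 1) ∨
      (∃ j, j ≤ 3 ∧ ∑ v, deg H v * deg H v + 4 * (s - 3) + 2 * j = s * (s + 1)) ∨
      ∑ v, deg H v * deg H v + 6 * (s - 4) ≤ s * (s + 1) := by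
  have hne : (univ : Finset V).Nonempty := by
    obtain ⟨e, he⟩ := card_pos.mp (by omega : 0 < H.edgeFinset.card)
    revert he
    refine Sym2.ind (fun x y _ => ?_) e
    exact ⟨x, mem_univ x⟩
  obtain ⟨w, -, hwmax⟩ := exists_max_image univ (deg H) hne
  have hwle : deg H w ≤ H.edgeFinset.card := by
    rw [deg_eq_degree, ← SimpleGraph.card_incidenceFinset_eq_degree]
    exact card_le_card (H.incidenceFinset_subset w)
  rcases lt_trichotomy (deg H w + 2) s with hlt | heq | hgt
  · right; right; right; right
    have hΔ : ∀ v, deg H v + 3 ≤ H.edgeFinset.card := fun v => by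
      have := hwmax v (mem_univ v)
      omega
    have := sum_deg_sq_le_of_maxdeg3 H hfree (by omega) hΔ
    rw [hm] at this
    exact this
  · right; right; right; left
    have := sum_deg_sq_two_off_band H hfree w (by omega) (by omega)
    rw [hm] at this
    exact this
  · rcases Nat.eq_or_lt_of_le (show s ≤ deg H w + 1 by omega) with heq1 | hlt1
    · obtain ⟨e, he, hwe⟩ := exists_edge_not_mem H w (by omega)
      have hall := mem_of_ne_of_deg_eq_pred H w (by omega) e he hwe
      by_cases hend : ∀ u ∈ e, ¬ H.Adj w u
      · right; right; left
        have := sum_deg_sq_of_star_plus_pair H w (by omega) e he hwe hend hall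
        rw [hm] at this
        exact this
      · right; left
        obtain ⟨u, hu, hadj⟩ : ∃ u ∈ e, H.Adj w u := by
          by_contra h
          exact hend (fun u hu hadj => h ⟨u, hu, hadj⟩)
        obtain ⟨v, rfl⟩ := Sym2.mem_iff_exists.mp hu
        have huv : H.Adj u v := (SimpleGraph.mem_edgeSet H).mp (SimpleGraph.mem_edgeFinset.mp he)
        have hwv : w ≠ v := fun h => hwe (h ▸ Sym2.mem_mk_right u v)
        have hu2 : 2 ≤ deg H u := two_le_deg_of_adj_adj H u w v hwv hadj.symm huv
        have h1 := sum_deg_sq_ge_of_adj H w u (by omega) hadj hu2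
        have h2 := sum_deg_sq_le_of_not_star H hfree (by omega)
          (fun v => exists_edge_not_mem H v (by have := hwmax v (mem_univ v); omega))
        rw [hm] at h1 h2
        omega
    · left
      have hwr : deg H w = H.edgeFinset.card := by omega
      have := sum_deg_sq_eq_of_deg_eq_card H w hwr
      rw [hm] at this
      exact this

end C047

end TriangleCap

end PercRepro
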